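import Literature.Computability.MetaComplexity.GaussianWidthDepthFregeChain
import HarnessLib

/-!
# Gaussian width bounds bounded-depth Frege size from above

**Theorem** (`depthFrege_upperBound_of_gaussianWidth`, folklore simulation; the "upper half"
of the Gaussian-width picture of bounded-depth Frege for XOR-CNFs, Galesi–Itsykson–Riazanov–
Sofronova 2023, §4, for Tseitin formulas). There are absolute constants `d₀ = 17` and `C = 58`
such that for every system `E : Fin m → LinEqMod 2 n` over `𝔽₂` with rows of `≤ ℓ` variables and
Gaussian width `≤ w` (`gaussianWidth`, `GaussianWidth.lean`: a Gaussian-calculus refutation all of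
whose lines have `≤ w` variables), the negated parity CNF `¬ ofCNF (sumEncoding 1 E)` has a
`textbookFrege` proof of alternation depth `≤ 17` and size
`≤ ((m+2)(n+2)^{w+ℓ})^{58} = (m+2)^{58} (n+2)^{58 (w+ℓ)}`, i.e. `poly(m) · n^{O(w+ℓ)}`.

Proof: `ParityDNF.lean` (parity DNFs), `DepthFregeLocalChain.lean` (local semantic steps in a
carried conjunction), `GaussianWidthDepthFregeRows.lean` (the rows), `GaussianWidthDepthFregeChain.lean`
(the deduplicated chain along the refutation) give a bounded derivation `BD 16 B Λ (¬F)` with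
explicit `Λ` and `B`; this file only turns `Λ · B` into the displayed monomial
(`GaussFrege.xc/xm/xa/xp`: every quantity is `≤ X^k` for `X = (m+2)(n+2)^{w+ℓ} ≥ 2`).

Also the form literally matching the route item
`Summit.PneNP.PneNP.Theses.MatroidTseitin.GaussianWidthDepthFregeUB` (hypothesis: a
symmetric-difference derivation of an odd empty row sum with all row sums of `≤ w` variables;
`gaussianWidth_le_iff`): `depthFrege_upperBound_of_rowSets`.

References: E. Ben-Sasson, R. Impagliazzo, *Random CNF's are hard for the polynomial calculus*,
Comput. Complexity 19 (2010) (Gaussian width, after Alekhnovich); N. Galesi, D. Itsykson,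
A. Riazanov, A. Sofronova, *Bounded-depth Frege complexity of Tseitin formulas for all graphs*,
APAL 174 (2023), Lemma 4 and §4 (the matching upper bound `2^{tw(G)^{O(1/d)}} poly` for Tseitin
formulas is proved there by the same kind of brute-force local derivations; the fixed-depth
`n^{O(w)}` simulation of a width-`w` Gaussian refutation is folklore).
-/

namespace Literature.Computability.MetaComplexity

open Complexity Complexity.PropForm TextbookFrege KrajicekRamsey Finset

/-! ### Monomial bookkeeping: everything is `≤ X^k` -/

namespace GaussFrege

variable {X a b c i j k : ℕ}

/-- Constants: `c ≤ 2^k ≤ X^k`. [folklore] -/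
theorem xc (hX : 2 ≤ X) (hc : c ≤ 2 ^ k) : c ≤ X ^ k :=
  hc.trans (Nat.pow_le_pow_left hX k)

/-- Products: exponents add. [folklore] -/
theorem xm (ha : a ≤ X ^ i) (hb : b ≤ X ^ j) : a * b ≤ X ^ (i + j) := by
  rw [pow_add]; exact Nat.mul_le_mul ha hb

/-- Sums: one more than the larger exponent (`X ≥ 2`). [folklore] -/
theorem xa (hX : 2 ≤ X) (ha : a ≤ X ^ i) (hb : b ≤ X ^ j) : a + b ≤ X ^ (max i j + 1) := by
  have h1 : X ^ i ≤ X ^ max i j := Nat.pow_le_pow_right (by omega) (le_max_left _ _)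
  have h2 : X ^ j ≤ X ^ max i j := Nat.pow_le_pow_right (by omega) (le_max_right _ _)
  calc a + b ≤ X ^ max i j + X ^ max i j := add_le_add (ha.trans h1) (hb.trans h2)
    _ = 2 * X ^ max i j := by ring
    _ ≤ X * X ^ max i j := Nat.mul_le_mul_right _ hX
    _ = X ^ (max i j + 1) := by rw [pow_succ]; ring

/-- Powers: exponents multiply. [folklore] -/
theorem xp (ha : a ≤ X ^ i) (k : ℕ) : a ^ k ≤ X ^ (i * k) := by
  rw [pow_mul]; exact Nat.pow_le_pow_left ha k

/-- Raising the exponent (`X ≥ 1`). [folklore] -/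
theorem xle (hX : 2 ≤ X) (ha : a ≤ X ^ i) (hij : i ≤ j) : a ≤ X ^ j :=
  ha.trans (Nat.pow_le_pow_right (by omega) hij)

end GaussFrege

open GaussFrege

/-! ### The main theorem -/

section Main

variable {m n : ℕ}

/-- **Bounded-depth Frege refutations from Gaussian width (folklore simulation).** For an
`ℓ`-sparse system `E` over `𝔽₂` of Gaussian width `≤ w`, the negated parity CNF
`¬ ofCNF (sumEncoding 1 E)` has a `textbookFrege` proof of alternation depth `≤ 17` and size at
most `((m+2)(n+2)^{w+ℓ})^{58}`. [cite: GalesiEtAl2023, §4 (upper bound technique)] -/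
theorem depthFrege_upperBound_of_gaussianWidth {ℓ w : ℕ} (E : Fin m → LinEqMod 2 n)
    (hE : ∀ e, (E e).supp.card ≤ ℓ) (hgw : gaussianWidth E ≤ w) :
    ∃ π : List (PropForm ℕ),
      textbookFrege.IsDepthProofOf 17 π (neg (PropForm.ofCNF (sumEncoding 1 E))) ∧
      proofSize π ≤ ((m + 2) * (n + 2) ^ (w + ℓ)) ^ 58 := by
  obtain ⟨t, L, hL, hwL⟩ := (gaussianWidth_le_iff_lines E w).1 hgw
  -- parameters
  set SF := (PropForm.ofCNF (sumEncoding 1 E)).size with hSF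
  set P := 2 ^ (w + ℓ) * (3 * (w + ℓ) + 2) + 1 with hP
  set Q := m + 2 * (n + 1) ^ w + 1 with hQ
  set r := 2 ^ ℓ * (3 * ℓ + 4) with hr
  set B := 128 * (Q * (P + 1) + 1) + 40 * (P + r + ℓ) + 16 * SF + 80 * w + 1400 with hB
  have hSFle : SF ≤ m * (2 ^ ℓ * (3 * ℓ + 2)) + 1 := size_ofCNF_sumEncoding_le E hE
  have hPℓ : 2 ^ ℓ * (3 * ℓ + 2) + 1 ≤ P := by
    have h1 : 2 ^ ℓ ≤ 2 ^ (w + ℓ) := Nat.pow_le_pow_right (by norm_num) (Nat.le_add_left _ _)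
    have h2 : 3 * ℓ + 2 ≤ 3 * (w + ℓ) + 2 := by omega
    exact Nat.succ_le_succ (Nat.mul_le_mul h1 h2)
  have hQ1 : 1 ≤ Q := by omega
  have hPQ : P ≤ Q * (P + 1) :=
    calc P ≤ 1 * (P + 1) := by omega
      _ ≤ Q * (P + 1) := Nat.mul_le_mul_right _ hQ1
  have hmQ : m * (P + 1) ≤ Q * (P + 1) := Nat.mul_le_mul_right _ (by omega)
  -- the rows
  have h0 := rowsFoldS E hE hPℓ (D := 16) (B := B) le_rfl (by omega) (List.finRange m)
    (by rw [List.length_finRange]; omega)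
  rw [List.length_finRange] at h0
  have hrows : ((List.finRange m).map fun e => parityForm (E e)) = (rowList E).map parityForm := by
    simp [rowList, List.map_map, Function.comp_def]
  rw [hrows] at h0
  -- the chain along the refutation
  have hΦB : 8 * (neg (PropForm.ofCNF (sumEncoding 1 E))).size ≤ B := by
    simp only [size]; omega
  have fin := refuteS hL hwL hE (le_refl P) (le_refl Q) (D := 16) le_rfl (B := B) (by omega) hΦB h0
  obtain ⟨π, hπ, hsize⟩ := fin.exists_isDepthProofOf
  refine ⟨π, hπ, hsize.trans ?_⟩
  -- numerics: everything is `≤ X^k`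
  set X := (m + 2) * (n + 2) ^ (w + ℓ) with hX
  have hpos : 1 ≤ (n + 2) ^ (w + ℓ) := Nat.one_le_pow _ _ (by omega)
  have hX2 : 2 ≤ X := by
    calc 2 ≤ (m + 2) * 1 := by omega
      _ ≤ X := Nat.mul_le_mul_left _ hpos
  have hW2 : 2 ^ (w + ℓ) ≤ X ^ 1 := by
    rw [pow_one]
    calc 2 ^ (w + ℓ) ≤ (n + 2) ^ (w + ℓ) := Nat.pow_le_pow_left (by omega) _
      _ ≤ X := Nat.le_mul_of_pos_left _ (by omega)
  have hWX : w + ℓ ≤ X ^ 1 := (Nat.lt_two_pow_self).le.trans hW2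
  have h2ℓ : 2 ^ ℓ ≤ X ^ 1 := (Nat.pow_le_pow_right (by norm_num) (Nat.le_add_left _ _)).trans hW2
  have h2w : 2 ^ w ≤ X ^ 1 := (Nat.pow_le_pow_right (by norm_num) (Nat.le_add_right _ _)).trans hW2
  have h22w : 2 ^ (2 * w) ≤ X ^ 2 := by
    rw [Nat.mul_comm, pow_mul]; exact xp h2w 2
  have hℓX : ℓ ≤ X ^ 1 := le_trans (Nat.le_add_left _ _) hWX
  have hwX : w ≤ X ^ 1 := le_trans (Nat.le_add_right _ _) hWX
  have hmX : m ≤ X ^ 1 := by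
    rw [pow_one]
    calc m ≤ (m + 2) * 1 := by omega
      _ ≤ X := Nat.mul_le_mul_left _ hpos
  have hnw : (n + 1) ^ w ≤ X ^ 1 := by
    rw [pow_one]
    calc (n + 1) ^ w ≤ (n + 2) ^ w := Nat.pow_le_pow_left (by omega) _
      _ ≤ (n + 2) ^ (w + ℓ) := Nat.pow_le_pow_right (by omega) (Nat.le_add_right _ _)
      _ ≤ X := Nat.le_mul_of_pos_left _ (by omega)
  have c2 : 2 ≤ X ^ 1 := xc hX2 (by norm_num)
  have c3 : 3 ≤ X ^ 2 := xc hX2 (by norm_num)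
  have c4 : 4 ≤ X ^ 2 := xc hX2 (by norm_num)
  have c5 : 5 ≤ X ^ 3 := xc hX2 (by norm_num)
  have c6 : 6 ≤ X ^ 3 := xc hX2 (by norm_num)
  have c8 : 8 ≤ X ^ 3 := xc hX2 (by norm_num)
  have c40 : 40 ≤ X ^ 6 := xc hX2 (by norm_num)
  have c50 : 50 ≤ X ^ 6 := xc hX2 (by norm_num)
  have c51 : 51 ≤ X ^ 6 := xc hX2 (by norm_num)
  have c80 : 80 ≤ X ^ 7 := xc hX2 (by norm_num)
  have c100 : 100 ≤ X ^ 7 := xc hX2 (by norm_num)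
  have c126 : 126 ≤ X ^ 7 := xc hX2 (by norm_num)
  have c128 : 128 ≤ X ^ 7 := xc hX2 (by norm_num)
  have c130 : 130 ≤ X ^ 8 := xc hX2 (by norm_num)
  have c252 : 252 ≤ X ^ 8 := xc hX2 (by norm_num)
  have c458 : 458 ≤ X ^ 9 := xc hX2 (by norm_num)
  have c500 : 500 ≤ X ^ 9 := xc hX2 (by norm_num)
  have c1400 : 1400 ≤ X ^ 11 := xc hX2 (by norm_num)
  have c3000 : 3000 ≤ X ^ 12 := xc hX2 (by norm_num)
  have c8000 : 8000 ≤ X ^ 13 := xc hX2 (by norm_num)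
  have c1 : 1 ≤ X ^ 0 := by rw [pow_zero]
  -- P ≤ X^6, Q ≤ X^4, SF ≤ X^7, r ≤ X^5, B ≤ X^23
  have b3W : 3 * (w + ℓ) + 2 ≤ X ^ 4 := xa hX2 (xm c3 hWX) c2
  have bP : P ≤ X ^ 6 := xa hX2 (xm hW2 b3W) c1
  have bQ : Q ≤ X ^ 4 := xa hX2 (xa hX2 hmX (xm c2 hnw)) c1
  have b3ℓ : 3 * ℓ + 2 ≤ X ^ 4 := xa hX2 (xm c3 hℓX) c2
  have bSF : SF ≤ X ^ 7 := hSFle.trans (xa hX2 (xm hmX (xm h2ℓ b3ℓ)) c1)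
  have br : r ≤ X ^ 5 := xm h2ℓ (xa hX2 (xm c3 hℓX) c4)
  have bP1 : P + 1 ≤ X ^ 7 := xa hX2 bP c1
  have bQP : Q * (P + 1) + 1 ≤ X ^ 12 := xa hX2 (xm bQ bP1) c1
  have bB : B ≤ X ^ 23 :=
    xa hX2 (xa hX2 (xa hX2 (xa hX2 (xm c128 bQP) (xm c40 (xa hX2 (xa hX2 bP br) hℓX)))
      (xm (xc hX2 (show 16 ≤ 2 ^ 4 by norm_num)) bSF)) (xm c80 hwX)) c1400
  -- stepLines ≤ X^30
  have b2w : 2 * w ≤ X ^ 2 := xm c2 hwX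
  have bSt : stepLines P Q (2 * w) ≤ X ^ 30 := by
    unfold stepLines
    have t1 : (3 * P + 5) * (100 * (2 * w + 8) ^ 2) ≤ X ^ 24 :=
      xm (xa hX2 (xm c3 bP) c5) (xm c100 (xp (xa hX2 b2w c8) 2))
    have t2 : 50 * (2 * w + 6) ^ 2 ≤ X ^ 14 := xm c50 (xp (xa hX2 b2w c6) 2)
    exact xa hX2 (xa hX2 (xm h22w (xa hX2 (xa hX2 t1 t2) c2)) (xm c252 bQ)) c8000
  -- rowLines ≤ X^28
  have bRw : rowLines ℓ P SF ≤ X ^ 28 := by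
    unfold rowLines
    have t1 : (P + 1 + 2 ^ ℓ * (3 * ℓ + 4)) * (100 * (ℓ + 8) ^ 2) ≤ X ^ 23 :=
      xm (xa hX2 bP1 br) (xm c100 (xp (xa hX2 hℓX c8) 2))
    have t2 : 50 * (ℓ + 2 ^ ℓ + 4) ^ 2 ≤ X ^ 12 := xm c50 (xp (xa hX2 (xa hX2 hℓX h2ℓ) c4) 2)
    have t3 : 50 * (2 ^ ℓ + 4) ^ 2 ≤ X ^ 12 := xm c50 (xp (xa hX2 h2ℓ c4) 2)
    have t4 : 2 ^ ℓ * (130 * (SF + 2) + 50 * (2 ^ ℓ + 4) ^ 2 + 458) ≤ X ^ 19 :=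
      xm h2ℓ (xa hX2 (xa hX2 (xm c130 (xa hX2 bSF c2)) t3) c458)
    exact xa hX2 (xa hX2 (xm h2ℓ (xa hX2 (xa hX2 t1 t2) c2)) t3) t4
  -- total lines ≤ X^35, size ≤ X^58
  have bL : m * (rowLines ℓ P SF + 51) + 500 + 2 * (n + 1) ^ w * stepLines P Q (2 * w) +
      126 * Q + 3000 ≤ X ^ 35 :=
    xa hX2 (xa hX2 (xa hX2 (xa hX2 (xm hmX (xa hX2 bRw c51)) c500) (xm (xm c2 hnw) bSt))
      (xm c126 bQ)) c3000
  have := xm bL bB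
  exact this

/-- **The same with the monomial split**: size `≤ (m+2)^{58} (n+2)^{58 (w+ℓ)}` at depth `17`.
[cite: GalesiEtAl2023, §4 (upper bound technique)] -/
theorem depthFrege_upperBound_of_gaussianWidth' {ℓ w : ℕ} (E : Fin m → LinEqMod 2 n)
    (hE : ∀ e, (E e).supp.card ≤ ℓ) (hgw : gaussianWidth E ≤ w) :
    ∃ π : List (PropForm ℕ),
      textbookFrege.IsDepthProofOf 17 π (neg (PropForm.ofCNF (sumEncoding 1 E))) ∧
      proofSize π ≤ (m + 2) ^ 58 * (n + 2) ^ (58 * (w + ℓ)) := by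
  obtain ⟨π, hπ, hsize⟩ := depthFrege_upperBound_of_gaussianWidth E hE hgw
  refine ⟨π, hπ, hsize.trans (le_of_eq ?_)⟩
  rw [mul_pow, ← pow_mul, Nat.mul_comm (w + ℓ) 58]

/-- **The route form.** For every `ℓ`-sparse system over `𝔽₂` admitting a symmetric-difference
derivation `S₀, …, S_t` of row sets (each a single row or the symmetric difference of two earlier
ones) whose row sums all have `≤ w` variables and whose last row sum is `0 = 1`, the negated
parity CNF has a depth-`17` `textbookFrege` proof of size `≤ (m+2)^{58} (n+2)^{58 (w+ℓ)}`. This is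
literally the body of `Summit.PneNP.PneNP.Theses.MatroidTseitin.GaussianWidthDepthFregeUB` with
`d₀ = 17`, `C = 58`. [cite: GalesiEtAl2023, §4 (upper bound technique)] -/
theorem depthFrege_upperBound_of_rowSets (ℓ m n w : ℕ) (E : Fin m → LinEqMod 2 n)
    (hE : ∀ e, (E e).supp.card ≤ ℓ)
    (hS : ∃ (t : ℕ) (S : Fin (t + 1) → Finset (Fin m)),
      (∀ i, (∃ e, S i = {e}) ∨ (∃ j k, j < i ∧ k < i ∧ S i = symmDiff (S j) (S k))) ∧
      (∀ i, (lincomb (fun e => if e ∈ S i then (1 : ZMod 2) else 0) E).supp.card ≤ w) ∧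
      (lincomb (fun e => if e ∈ S (Fin.last t) then (1 : ZMod 2) else 0) E).1 = 0 ∧
      (lincomb (fun e => if e ∈ S (Fin.last t) then (1 : ZMod 2) else 0) E).2 = 1) :
    ∃ π : List (PropForm ℕ),
      textbookFrege.IsDepthProofOf 17 π (neg (PropForm.ofCNF (sumEncoding 1 E))) ∧
      proofSize π ≤ (m + 2) ^ 58 * (n + 2) ^ (58 * (w + ℓ)) :=
  depthFrege_upperBound_of_gaussianWidth' E hE ((gaussianWidth_le_iff E w).2 hS)

end Main

end Literature.Computability.MetaComplexity
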